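import Mathlib
import HarnessLib

/-!
# Nevai's locality lemma for Chebyshev test polynomials (`stub_mnLocality`)

Stub `stub_mnLocality` of the line `FilterInvariance` of the crux
`EmbeddedDrudeMourre.GreenKuboContinuation` (item stmt-AtomisticToContinuum-12597): one of the
six elementary pieces of the Máté–Nevai bounded-variation theorem.

Setting: `τ` is a measure on `ℝ` for which every polynomial is integrable, `p : ℕ → ℝ[X]` is
orthonormal in `L²(τ)` and satisfies the three-term recurrence
`x p_{n+1} = A_{n+1} p_{n+2} + A_n p_n` with `A_n → 1/2`.

* `mnLoc_tendsto_chebyshev_entry` (Nevai 1979, *Orthogonal polynomials*, Mem. AMS 213, §4.1):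
  for all `m i j : ℕ`, `∫ T_m p_{n+i} p_{n+j} dτ → ([j = i + m] + [i = j + m]) / 2` as `n → ∞`,
  where `T_m` is the Chebyshev polynomial of the first kind. These limits are the bulk matrix
  entries of `T_m(J₀)` for the free Jacobi matrix `J₀` (zero diagonal, off-diagonal entries
  `1/2`), for which `T_m(J₀) = (S^m + S^{-m}) / 2` with `S` the shift. The proof is a two-step
  induction on `m` using `T_{m+2} = 2 x T_{m+1} - T_m` and the recurrence of `p`, after shifting
  the sequence index `n` by one (so the edge relation `x p_0 = A_0 p_1` is never needed).
* `stub_mnLocality`: for the Turán forms `S_n = p_{n+1}² - (x / A_n) p_{n+1} p_n + p_n²`,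
  `∫ T_m S_n dτ → 1, 0, -1/2, 0, 0, …` (`m = 0, 1, 2, ≥ 3`), by expanding `S_n` into three such
  matrix entries (`A_n⁻¹ → 2`).

No bounded variation and no evenness of `τ` is used; positivity of `A` and the edge relation are
hypotheses of the registered signature but are not needed by the proof.
-/
noncomputable section

namespace Summit.AtomisticToContinuum.FouriersLaw.Theorems.GreenKuboContinuation.BandLimitedKrylov

open Filter Topology MeasureTheory Set Polynomial

/-- If every polynomial is `τ`-integrable, so is `ω ↦ f(ω) (g(ω) h(ω))` for polynomials
`f g h`. [folklore] -/
theorem mnLoc_integrable_mul₃ (τ : Measure ℝ)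
    (hint : ∀ f : ℝ[X], Integrable (fun ω => f.eval ω) τ) (f g h : ℝ[X]) :
    Integrable (fun ω => f.eval ω * (g.eval ω * h.eval ω)) τ := by
  simpa only [eval_mul] using hint (f * (g * h))

/-- One step of the three-term recurrence under the integral sign: for every polynomial `q`,
`∫ (x q) p_{k+1} p_l dτ = A_{k+1} ∫ q p_{k+2} p_l dτ + A_k ∫ q p_k p_l dτ`. [folklore] -/
theorem mnLoc_integral_X_mul (τ : Measure ℝ) (p : ℕ → ℝ[X]) (A : ℕ → ℝ)
    (hint : ∀ f : ℝ[X], Integrable (fun ω => f.eval ω) τ)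
    (hrec : ∀ n, X * p (n + 1) = C (A (n + 1)) * p (n + 2) + C (A n) * p n)
    (q : ℝ[X]) (k l : ℕ) :
    ∫ ω, (X * q).eval ω * ((p (k + 1)).eval ω * (p l).eval ω) ∂τ =
      A (k + 1) * ∫ ω, q.eval ω * ((p (k + 2)).eval ω * (p l).eval ω) ∂τ +
        A k * ∫ ω, q.eval ω * ((p k).eval ω * (p l).eval ω) ∂τ := by
  have key : ∀ ω, (X * q).eval ω * ((p (k + 1)).eval ω * (p l).eval ω) =
      A (k + 1) * (q.eval ω * ((p (k + 2)).eval ω * (p l).eval ω)) +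
        A k * (q.eval ω * ((p k).eval ω * (p l).eval ω)) := by
    intro ω
    have h := congrArg (fun f => f.eval ω) (hrec k)
    simp only [eval_mul, eval_X, eval_add, eval_C] at h ⊢
    have e : ω * q.eval ω * ((p (k + 1)).eval ω * (p l).eval ω) =
        q.eval ω * (ω * (p (k + 1)).eval ω) * (p l).eval ω := by ring
    rw [e, h]
    ring
  simp_rw [key]
  rw [integral_add ((mnLoc_integrable_mul₃ τ hint _ _ _).const_mul _)
    ((mnLoc_integrable_mul₃ τ hint _ _ _).const_mul _), integral_const_mul, integral_const_mul]

/-- Limit version of `mnLoc_integral_X_mul` in the bulk: if `∫ q p_{n+i+2} p_{n+j+1} dτ → l₁` and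
`∫ q p_{n+i} p_{n+j+1} dτ → l₂`, then `∫ (x q) p_{n+i} p_{n+j} dτ → (l₁ + l₂) / 2`
(shift `n ↦ n + 1`, recurrence, `A_n → 1/2`). [folklore] -/
theorem mnLoc_tendsto_X_mul (τ : Measure ℝ) (p : ℕ → ℝ[X]) (A : ℕ → ℝ)
    (hint : ∀ f : ℝ[X], Integrable (fun ω => f.eval ω) τ)
    (hA : Tendsto A atTop (𝓝 (1 / 2)))
    (hrec : ∀ n, X * p (n + 1) = C (A (n + 1)) * p (n + 2) + C (A n) * p n)
    (q : ℝ[X]) (i j : ℕ) (l₁ l₂ : ℝ)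
    (h₁ : Tendsto (fun n : ℕ =>
      ∫ ω, q.eval ω * ((p (n + (i + 2))).eval ω * (p (n + (j + 1))).eval ω) ∂τ) atTop (𝓝 l₁))
    (h₂ : Tendsto (fun n : ℕ =>
      ∫ ω, q.eval ω * ((p (n + i)).eval ω * (p (n + (j + 1))).eval ω) ∂τ) atTop (𝓝 l₂)) :
    Tendsto (fun n : ℕ => ∫ ω, (X * q).eval ω * ((p (n + i)).eval ω * (p (n + j)).eval ω) ∂τ)
      atTop (𝓝 ((l₁ + l₂) / 2)) := by
  rw [← tendsto_add_atTop_iff_nat 1]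
  have hAi : Tendsto (fun n => A (n + i)) atTop (𝓝 (1 / 2)) := (tendsto_add_atTop_iff_nat i).2 hA
  have hAi1 : Tendsto (fun n => A (n + i + 1)) atTop (𝓝 (1 / 2)) :=
    (tendsto_add_atTop_iff_nat (i + 1)).2 hA
  have e : (fun n : ℕ =>
      ∫ ω, (X * q).eval ω * ((p (n + 1 + i)).eval ω * (p (n + 1 + j)).eval ω) ∂τ) = fun n : ℕ =>
      A (n + i + 1) * ∫ ω, q.eval ω * ((p (n + (i + 2))).eval ω * (p (n + (j + 1))).eval ω) ∂τ +
        A (n + i) * ∫ ω, q.eval ω * ((p (n + i)).eval ω * (p (n + (j + 1))).eval ω) ∂τ := by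
    funext n
    rw [Nat.add_right_comm n 1 i, Nat.add_right_comm n 1 j]
    exact mnLoc_integral_X_mul τ p A hint hrec q (n + i) (n + j + 1)
  rw [e]
  have hl : (l₁ + l₂) / 2 = 1 / 2 * l₁ + 1 / 2 * l₂ := by ring
  rw [hl]
  exact (hAi1.mul h₁).add (hAi.mul h₂)

/-- The case `m = 0` of the locality statement: `∫ T_0 p_{n+i} p_{n+j} dτ = δ_{ij}` is constant.
[folklore] -/
theorem mnLoc_tendsto_entry_zero (τ : Measure ℝ) (p : ℕ → ℝ[X])
    (horth : ∀ m n, ∫ ω, (p m).eval ω * (p n).eval ω ∂τ = if m = n then 1 else 0) (i j : ℕ) :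
    Tendsto (fun n : ℕ =>
      ∫ ω, (Chebyshev.T ℝ ((0 : ℕ) : ℤ)).eval ω * ((p (n + i)).eval ω * (p (n + j)).eval ω) ∂τ)
      atTop (𝓝 (if i = j then 1 else 0)) := by
  have e : (fun n : ℕ =>
      ∫ ω, (Chebyshev.T ℝ ((0 : ℕ) : ℤ)).eval ω * ((p (n + i)).eval ω * (p (n + j)).eval ω) ∂τ) =
      fun _ => if i = j then 1 else 0 := by
    funext n
    simp only [Nat.cast_zero, Chebyshev.T_zero, eval_one, one_mul, horth, Nat.add_left_cancel_iff]
  rw [e]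
  exact tendsto_const_nhds

/-- The combinatorial identity behind the induction step: the bulk matrix entries
`L_m(i, j) = ([j = i + m] + [i = j + m]) / 2` of `T_m(J₀)` satisfy
`L_{m+2}(i, j) = 2 · (L_{m+1}(i+2, j+1) + L_{m+1}(i, j+1)) / 2 - L_m(i, j)`. [folklore] -/
theorem mnLoc_limit_rec (m i j : ℕ) :
    ((if j = i + (m + 2) then (1 : ℝ) else 0) + (if i = j + (m + 2) then 1 else 0)) / 2 =
      2 * ((((if j + 1 = i + 2 + (m + 1) then (1 : ℝ) else 0) +
          (if i + 2 = j + 1 + (m + 1) then 1 else 0)) / 2 +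
        ((if j + 1 = i + (m + 1) then (1 : ℝ) else 0) +
          (if i = j + 1 + (m + 1) then 1 else 0)) / 2) / 2) -
      ((if j = i + m then (1 : ℝ) else 0) + (if i = j + m then 1 else 0)) / 2 := by
  have h3 : (j + 1 = i + 2 + (m + 1)) ↔ (j = i + (m + 2)) := by omega
  have h4 : (i + 2 = j + 1 + (m + 1)) ↔ (i = j + m) := by omega
  have h5 : (j + 1 = i + (m + 1)) ↔ (j = i + m) := by omega
  have h6 : (i = j + 1 + (m + 1)) ↔ (i = j + (m + 2)) := by omega
  simp only [h3, h4, h5, h6]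
  ring

/-- **Nevai's locality for Chebyshev test polynomials (bulk matrix entries).** If every
polynomial is `τ`-integrable, `p` is orthonormal in `L²(τ)` with
`x p_{n+1} = A_{n+1} p_{n+2} + A_n p_n` and `A_n → 1/2`, then for all `m i j`,
`∫ T_m p_{n+i} p_{n+j} dτ → ([j = i + m] + [i = j + m]) / 2` as `n → ∞`.
(Nevai 1979, Mem. AMS 213, §4.1.) [folklore] -/
theorem mnLoc_tendsto_chebyshev_entry (τ : Measure ℝ) (p : ℕ → ℝ[X]) (A : ℕ → ℝ)
    (hint : ∀ f : ℝ[X], Integrable (fun ω => f.eval ω) τ)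
    (horth : ∀ m n, ∫ ω, (p m).eval ω * (p n).eval ω ∂τ = if m = n then 1 else 0)
    (hA : Tendsto A atTop (𝓝 (1 / 2)))
    (hrec : ∀ n, X * p (n + 1) = C (A (n + 1)) * p (n + 2) + C (A n) * p n)
    (m i j : ℕ) :
    Tendsto (fun n : ℕ =>
      ∫ ω, (Chebyshev.T ℝ m).eval ω * ((p (n + i)).eval ω * (p (n + j)).eval ω) ∂τ)
      atTop (𝓝 (((if j = i + m then 1 else 0) + (if i = j + m then 1 else 0)) / 2)) := by
  induction m using Nat.twoStepInduction generalizing i j with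
  | zero =>
    have h := mnLoc_tendsto_entry_zero τ p horth i j
    convert h using 2
    have e : (j = i) ↔ (i = j) := eq_comm
    simp only [Nat.add_zero, e]
    ring
  | one =>
    have hT : Chebyshev.T ℝ ((1 : ℕ) : ℤ) = X * Chebyshev.T ℝ ((0 : ℕ) : ℤ) := by
      simp only [Nat.cast_one, Chebyshev.T_one, Nat.cast_zero, Chebyshev.T_zero, mul_one]
    rw [hT]
    have h := mnLoc_tendsto_X_mul τ p A hint hA hrec (Chebyshev.T ℝ ((0 : ℕ) : ℤ)) i j _ _
      (mnLoc_tendsto_entry_zero τ p horth (i + 2) (j + 1))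
      (mnLoc_tendsto_entry_zero τ p horth i (j + 1))
    convert h using 2
    have e : (i + 2 = j + 1) ↔ (j = i + 1) := by omega
    simp only [e]
  | more m hm hm1 =>
    have hX := mnLoc_tendsto_X_mul τ p A hint hA hrec (Chebyshev.T ℝ ((m + 1 : ℕ) : ℤ)) i j _ _
      (hm1 (i + 2) (j + 1)) (hm1 i (j + 1))
    have hT : Chebyshev.T ℝ ((m + 2 : ℕ) : ℤ) =
        2 * (X * Chebyshev.T ℝ ((m + 1 : ℕ) : ℤ)) - Chebyshev.T ℝ (m : ℤ) := by
      push_cast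
      rw [Chebyshev.T_add_two]
      ring
    have e : (fun n : ℕ =>
        ∫ ω, (Chebyshev.T ℝ ((m + 2 : ℕ) : ℤ)).eval ω *
          ((p (n + i)).eval ω * (p (n + j)).eval ω) ∂τ) = fun n : ℕ =>
        2 * ∫ ω, (X * Chebyshev.T ℝ ((m + 1 : ℕ) : ℤ)).eval ω *
            ((p (n + i)).eval ω * (p (n + j)).eval ω) ∂τ -
          ∫ ω, (Chebyshev.T ℝ (m : ℤ)).eval ω * ((p (n + i)).eval ω * (p (n + j)).eval ω) ∂τ := by
      funext n
      rw [← integral_const_mul, ← integral_sub ((mnLoc_integrable_mul₃ τ hint _ _ _).const_mul _)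
        (mnLoc_integrable_mul₃ τ hint _ _ _)]
      congr 1
      funext ω
      rw [hT]
      simp only [eval_sub, eval_mul, eval_ofNat, eval_X]
      ring
    rw [e]
    have h := (hX.const_mul 2).sub (hm i j)
    convert h using 2
    exact mnLoc_limit_rec m i j

/-- The value of the limit in `stub_mnLocality`, assembled from the bulk matrix entries
`L_m(1,1) - 2 · (L_m(3,1) + L_m(1,1)) / 2 + L_m(0,0)`. [folklore] -/
theorem mnLoc_limit_value (m : ℕ) :
    (if m = 0 then (1 : ℝ) else if m = 2 then -(1 / 2) else 0) =
      ((if 1 = 1 + m then (1 : ℝ) else 0) + (if 1 = 1 + m then 1 else 0)) / 2 -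
        2 * ((((if 1 = 3 + m then (1 : ℝ) else 0) + (if 3 = 1 + m then 1 else 0)) / 2 +
          ((if 1 = 1 + m then (1 : ℝ) else 0) + (if 1 = 1 + m then 1 else 0)) / 2) / 2) +
        ((if 0 = 0 + m then (1 : ℝ) else 0) + (if 0 = 0 + m then 1 else 0)) / 2 := by
  have h1 : (1 = 1 + m) ↔ (m = 0) := by omega
  have h2 : ¬ (1 = 3 + m) := by omega
  have h3 : (3 = 1 + m) ↔ (m = 2) := by omega
  have h4 : (0 = 0 + m) ↔ (m = 0) := by omega
  simp only [h1, h2, h3, h4, if_false]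
  split_ifs <;> norm_num
  omega

/-- **`stub_mnLocality` — Nevai's locality (weak-limit) lemma for the class `a_n → 1/2, b_n = 0`,
tested against Chebyshev polynomials.** If every polynomial is `τ`-integrable, `p_n` is
orthonormal in `L²(τ)` and satisfies `x p_0 = A_0 p_1`, `x p_{n+1} = A_{n+1} p_{n+2} + A_n p_n`
with `A_n > 0`, `A_n → 1/2`, then for the Turán forms
`S_n = p_{n+1}² - (x / A_n) p_{n+1} p_n + p_n²` and every `m`,
`∫ T_m S_n dτ → 1, 0, -1/2, 0, 0, …` (`m = 0, 1, 2, ≥ 3`). Proof: expand `S_n`, use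
`mnLoc_tendsto_chebyshev_entry` for the two squares and `mnLoc_tendsto_X_mul` for the cross term
(`(x / A_n) T_m p_{n+1} p_n = A_n⁻¹ (x T_m) p_{n+1} p_n`, `A_n⁻¹ → 2`).
(Nevai 1979, *Orthogonal polynomials*, Mem. AMS 213, §4.1; Van Assche LNM 1265 §2.) [folklore] -/
theorem stub_mnLocality :
    ∀ (τ : Measure ℝ) (p : ℕ → ℝ[X]) (A : ℕ → ℝ),
      (∀ f : ℝ[X], Integrable (fun ω => f.eval ω) τ) →
      (∀ m n, ∫ ω, (p m).eval ω * (p n).eval ω ∂τ = if m = n then 1 else 0) →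
      (∀ n, 0 < A n) → Tendsto A atTop (𝓝 (1 / 2)) →
      X * p 0 = C (A 0) * p 1 →
      (∀ n, X * p (n + 1) = C (A (n + 1)) * p (n + 2) + C (A n) * p n) →
      ∀ m : ℕ,
        Tendsto
          (fun n : ℕ => ∫ ω, (Polynomial.Chebyshev.T ℝ m).eval ω *
            (((p (n + 1)).eval ω) ^ 2 - ω / A n * (p (n + 1)).eval ω * (p n).eval ω
              + ((p n).eval ω) ^ 2) ∂τ)
          atTop (𝓝 (if m = 0 then 1 else if m = 2 then -(1 / 2) else 0)) := by
  intro τ p A hint horth _hApos hA _hrec₀ hrec m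
  have h11 := mnLoc_tendsto_chebyshev_entry τ p A hint horth hA hrec m 1 1
  have h00 := mnLoc_tendsto_chebyshev_entry τ p A hint horth hA hrec m 0 0
  have hJ := mnLoc_tendsto_X_mul τ p A hint hA hrec (Chebyshev.T ℝ m) 1 0 _ _
    (mnLoc_tendsto_chebyshev_entry τ p A hint horth hA hrec m 3 1)
    (mnLoc_tendsto_chebyshev_entry τ p A hint horth hA hrec m 1 1)
  simp only [Nat.add_zero] at h00 hJ
  have hAinv : Tendsto (fun n => (A n)⁻¹) atTop (𝓝 2) := by
    have h := hA.inv₀ (by norm_num)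
    rw [one_div, inv_inv] at h
    exact h
  have key : ∀ n : ℕ, ∫ ω, (Chebyshev.T ℝ m).eval ω *
      (((p (n + 1)).eval ω) ^ 2 - ω / A n * (p (n + 1)).eval ω * (p n).eval ω
        + ((p n).eval ω) ^ 2) ∂τ =
      ∫ ω, (Chebyshev.T ℝ m).eval ω * ((p (n + 1)).eval ω * (p (n + 1)).eval ω) ∂τ -
        (A n)⁻¹ * ∫ ω, (X * Chebyshev.T ℝ m).eval ω * ((p (n + 1)).eval ω * (p n).eval ω) ∂τ +
        ∫ ω, (Chebyshev.T ℝ m).eval ω * ((p n).eval ω * (p n).eval ω) ∂τ := by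
    intro n
    have I₁ : Integrable (fun ω => (Chebyshev.T ℝ m).eval ω *
        ((p (n + 1)).eval ω * (p (n + 1)).eval ω)) τ := mnLoc_integrable_mul₃ τ hint _ _ _
    have I₂ : Integrable (fun ω => (A n)⁻¹ * ((X * Chebyshev.T ℝ m).eval ω *
        ((p (n + 1)).eval ω * (p n).eval ω))) τ := (mnLoc_integrable_mul₃ τ hint _ _ _).const_mul _
    have I₃ : Integrable (fun ω => (Chebyshev.T ℝ m).eval ω *
        ((p n).eval ω * (p n).eval ω)) τ := mnLoc_integrable_mul₃ τ hint _ _ _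
    have I₁₂ : Integrable (fun ω => (Chebyshev.T ℝ m).eval ω *
        ((p (n + 1)).eval ω * (p (n + 1)).eval ω) - (A n)⁻¹ * ((X * Chebyshev.T ℝ m).eval ω *
        ((p (n + 1)).eval ω * (p n).eval ω))) τ := I₁.sub I₂
    rw [← integral_const_mul, ← integral_sub I₁ I₂, ← integral_add I₁₂ I₃]
    congr 1
    funext ω
    simp only [eval_mul, eval_X]
    ring
  refine Tendsto.congr (fun n => (key n).symm) ?_
  have h := (h11.sub (hAinv.mul hJ)).add h00
  convert h using 2
  exact mnLoc_limit_value m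

end Summit.AtomisticToContinuum.FouriersLaw.Theorems.GreenKuboContinuation.BandLimitedKrylov

end
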